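import Mathlib.Data.Nat.Choose.Bounds
import Summits.ValiantsHypothesis.ValiantsHypothesis.Theorems.KPlusLogSqLawOctaveLiveEnvelope
import Summits.ValiantsHypothesis.ValiantsHypothesis.Theorems.KPlusLogSqLawTropicalBSmallFormats

/-!
# Route «KPlusLogSqLaw», octave line — COUNTING the live breakpoints: `#liveBreaks ≤ multichoose(K,m) − 1`, and the trivial regime of the slack form

HONEST FRAMING.  Prover seat val-width-19561-oc1 (g2), `--supports stmt-ValiantsHypothesis-19561`.  `OctaveWeakLifting` (Ω-W),
`WeakLifting` (stmt-19561), `TropicalB` (stmt-19771), Conjecture B are OPEN; `LiveBreaksBound`, `DeadClassLifting` are DEFINED (g0),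
NOT asserted.  Everything in this file is COUNTING (the live analogue of the cell's slope-class law `tropRowD_slopeCount`) and
therefore says nothing inside the window where the octave line's crux has content; VP ≠ VNP is not moved.

WHY (memo `Cruxes/WeakLifting/Lines/octave-masking.md`, §1(a)).  g0 typed the masking question in its SHARP form
`LiveBreaksBound : TropRowD m K n → #liveBreaks ≤ n`.  The form the deciding chain needs carries the line's slack `2^{C(K+⌊log₂m⌋²)}·(n+1)`,
and with that slack the question is settled by counting in most formats: the live envelope is convex piecewise linear with slopes among
the `multichoose(K,m)` class multisets, so `#liveBreaks ≤ multichoose(K,m) − 1 ≤ min((m+1)^{K−1}, 2^{K+m−1}) − 1` for EVERY real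
pencil, dead classes or not (`liveBreaks_card_le_multichoose`, `liveBreaks_card_succ_le_succ_pow`, `liveBreaks_card_succ_le_two_pow`).
Hence the slack live-breaks bound — and with `octaveCount_le_liveBreaks` the slack dead-class lifting — hold OUTSIDE the window
`C·log₂ m ≲ K ≲ m/C` with nothing to prove about masking: `liveBreaks_card_le_slack_of_cone` (fat cone `m ≤ B·K`),
`liveBreaks_card_le_slack_of_thin` (`K ≤ K₀`, few classes), and the octave consequences `octaveCount_le_slack_of_cone` /
`…_of_thin` under `LiveDepthLE`.  The sharp form stays a calibration conjecture at small formats (m = 2: exact-LP evidence, memo §2–§5).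
-/

set_option linter.dupNamespace false
set_option autoImplicit false

namespace Summit.ValiantsHypothesis.ValiantsHypothesis.Theorems.KPlusLogSqLaw.Octave

open Polynomial Finset
open scoped BigOperators
open Summit.ValiantsHypothesis.ValiantsHypothesis.Theorems.LacunarySymmetroidMatrixDescartes.TropicalCensus (classSym slope_eq_of_classSym)

section LiveCount

variable {m K : ℕ}

/-- the raw slope is the census slope (cast to `ℤ`). [folklore] -/
theorem rawSlope_cast_eq_slope (d : Fin K → ℕ) (τ : RawTerm m K) :
    ((rawSlope d τ : ℕ) : ℤ) = Summit.ValiantsHypothesis.ValiantsHypothesis.Theorems.LacunarySymmetroidMatrixDescartes.TropicalCensus.slope d τ := by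
  unfold rawSlope Summit.ValiantsHypothesis.ValiantsHypothesis.Theorems.LacunarySymmetroidMatrixDescartes.TropicalCensus.slope
  push_cast
  rfl

/-- raw terms with the same class multiset have the same raw slope. [folklore] -/
theorem rawSlope_eq_of_classSym_eq (d : Fin K → ℕ) {τ τ' : RawTerm m K} (h : classSym τ = classSym τ') :
    rawSlope d τ = rawSlope d τ' := by
  have h1 := slope_eq_of_classSym d τ
  have h2 := slope_eq_of_classSym d τ'
  rw [h] at h1
  have : ((rawSlope d τ : ℕ) : ℤ) = ((rawSlope d τ' : ℕ) : ℤ) := by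
    rw [rawSlope_cast_eq_slope, rawSlope_cast_eq_slope, h1, h2]
  exact_mod_cast this

/-- **a live chain under the live envelope** (PROVED): if there are `N ≥ 1` live breakpoints, there are `N + 1` live raw terms that are
tops of the live envelope at `N + 1` interleaving points, with strictly increasing slopes. [folklore: convexity of the upper envelope] -/
theorem exists_liveChain (d : Fin K → ℕ) (S : Fin K → Matrix (Fin m) (Fin m) ℝ) (hN : 0 < (liveBreaks d S).card) :
    ∃ t : Fin ((liveBreaks d S).card + 1) → RawTerm m K, (∀ j, IsLiveTerm d S (t j)) ∧ StrictMono (fun j => rawSlope d (t j)) := by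
  classical
  set B := liveBreaks d S with hB
  set N := B.card with hNdef
  set P := (univ : Finset (RawTerm m K)).filter (fun τ => IsLiveTerm d S τ) with hP
  have hPne : P.Nonempty := by
    obtain ⟨b, hb⟩ := Finset.card_pos.1 hN
    rw [hB, liveBreaks, Finset.mem_image] at hb
    obtain ⟨kl, hkl, -⟩ := hb
    rw [Finset.mem_filter] at hkl
    exact ⟨kl.1, by rw [hP, Finset.mem_filter]; exact ⟨mem_univ _, hkl.2.1⟩⟩
  -- sorted breakpoints
  let b : Fin N → ℝ := fun i => B.orderEmbOfFin hNdef.symm i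
  have hbmono : StrictMono b := fun i j hij => (B.orderEmbOfFin hNdef.symm).strictMono hij
  have hbmem : ∀ i, b i ∈ B := fun i => Finset.orderEmbOfFin_mem B hNdef.symm i
  -- interleaving points
  let β : ℕ → ℝ := fun i => if h : i < N then b ⟨i, h⟩ else b ⟨N - 1, by omega⟩ + 1
  let βL : ℕ → ℝ := fun j => if j = 0 then b ⟨0, hN⟩ - 1 else β (j - 1)
  let θ : Fin (N + 1) → ℝ := fun j => (βL j + β j) / 2
  have hβ_eq : ∀ i : Fin N, β i = b i := fun i => by simp [β, i.2]
  have hβL_lt : ∀ i : Fin N, βL i < b i := by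
    intro i
    by_cases hi : (i : ℕ) = 0
    · have : i = ⟨0, hN⟩ := Fin.ext hi
      simp [βL, this]
    · simp only [βL, hi, if_false]
      have hlt : (i : ℕ) - 1 < N := by omega
      simp only [β, hlt, dif_pos]
      exact hbmono (Fin.mk_lt_mk.2 (by omega) : (⟨(i : ℕ) - 1, hlt⟩ : Fin N) < ⟨i, i.2⟩)
  have hβ_gt : ∀ i : Fin N, b i < β ((i : ℕ) + 1) := by
    intro i
    by_cases hi : (i : ℕ) + 1 < N
    · simp only [β, hi, dif_pos]
      exact hbmono (Fin.mk_lt_mk.2 (by omega) : (⟨(i : ℕ), i.2⟩ : Fin N) < ⟨i + 1, hi⟩)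
    · simp only [β, hi, dif_neg, not_false_eq_true]
      have : i = ⟨N - 1, by omega⟩ := Fin.ext (by simp; omega)
      rw [← this]; linarith
  have hleft : ∀ i : Fin N, θ i.castSucc < b i := by
    intro i
    show (βL (i : ℕ) + β (i : ℕ)) / 2 < b i
    have := hβL_lt i; have := hβ_eq i; linarith
  have hright : ∀ i : Fin N, b i < θ i.succ := by
    intro i
    show b i < (βL ((i : ℕ) + 1) + β ((i : ℕ) + 1)) / 2
    have h1 : βL ((i : ℕ) + 1) = b i := by
      simp only [βL, Nat.add_one_ne_zero, if_false, Nat.add_sub_cancel]; exact hβ_eq i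
    have := hβ_gt i; linarith
  -- top LIVE terms at the interleaving points
  have htop : ∀ j : Fin (N + 1), ∃ t ∈ P, ∀ τ ∈ P, rawLine d S τ (θ j) ≤ rawLine d S t (θ j) :=
    fun j => Finset.exists_max_image P (fun τ => rawLine d S τ (θ j)) hPne
  choose t htP htmax using htop
  have hlive : ∀ j, IsLiveTerm d S (t j) := fun j => by
    have := htP j; rw [hP, Finset.mem_filter] at this; exact this.2
  have hmax' : ∀ j τ, IsLiveTerm d S τ → rawLine d S τ (θ j) ≤ rawLine d S (t j) (θ j) := fun j τ hτ =>
    htmax j τ (by rw [hP, Finset.mem_filter]; exact ⟨mem_univ _, hτ⟩)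
  refine ⟨t, hlive, ?_⟩
  -- slopes strictly increase across each live breakpoint
  refine Fin.strictMono_iff_lt_succ.2 fun i => ?_
  have hbi := hbmem i
  rw [hB, liveBreaks, Finset.mem_image] at hbi
  obtain ⟨kl, hkl, hc⟩ := hbi
  rw [Finset.mem_filter] at hkl
  obtain ⟨-, hk, hl, hs, hall⟩ := hkl
  have hcross := rawLine_cross d S kl.1 kl.2 hs
  have htopk : ∀ τ, IsLiveTerm d S τ → rawLine d S τ (b i) ≤ rawLine d S kl.1 (b i) := fun τ hτ => by
    have := hall τ hτ; rw [hc] at this; exact this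
  have htopl : ∀ τ, IsLiveTerm d S τ → rawLine d S τ (b i) ≤ rawLine d S kl.2 (b i) := fun τ hτ => by
    have h1 := htopk τ hτ
    have h2 : rawLine d S kl.1 (b i) = rawLine d S kl.2 (b i) := by rw [← hc]; exact hcross
    linarith
  have a1 : rawSlope d (t i.castSucc) ≤ rawSlope d kl.1 :=
    slope_le_of_top_left (hleft i) (hmax' _ kl.1 hk) (htopk _ (hlive _))
  have a2 : rawSlope d (t i.castSucc) ≤ rawSlope d kl.2 :=
    slope_le_of_top_left (hleft i) (hmax' _ kl.2 hl) (htopl _ (hlive _))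
  have a3 : rawSlope d kl.1 ≤ rawSlope d (t i.succ) :=
    le_slope_of_top_right (hright i) (hmax' _ kl.1 hk) (htopk _ (hlive _))
  have a4 : rawSlope d kl.2 ≤ rawSlope d (t i.succ) :=
    le_slope_of_top_right (hright i) (hmax' _ kl.2 hl) (htopl _ (hlive _))
  show rawSlope d (t i.castSucc) < rawSlope d (t i.succ)
  rcases lt_or_gt_of_ne hs with h | h <;> omega

/-- **COUNTING the live breakpoints** (PROVED, every real pencil, dead classes or not): `#liveBreaks ≤ multichoose(K, m) − 1` — the class
multisets along a live chain are pairwise distinct.  (Live twin of `tropRowD_slopeCount`; the sharp `LiveBreaksBound` would replace the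
right side by the tropical row.) [folklore] -/
theorem liveBreaks_card_le_multichoose (d : Fin K → ℕ) (S : Fin K → Matrix (Fin m) (Fin m) ℝ) :
    (liveBreaks d S).card ≤ Nat.multichoose K m - 1 := by
  classical
  rcases Nat.eq_zero_or_pos (liveBreaks d S).card with h0 | hN
  · rw [h0]; exact Nat.zero_le _
  obtain ⟨t, -, hmono⟩ := exists_liveChain d S hN
  have hinj : Function.Injective fun j => classSym (t j) := by
    intro j j' h
    exact hmono.injective (rawSlope_eq_of_classSym_eq d h)
  have hcard := Fintype.card_le_of_injective _ hinj
  rw [Fintype.card_fin, Sym.card_sym_eq_multichoose, Fintype.card_fin] at hcard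
  omega

/-- … hence `#liveBreaks + 1 ≤ (m+1)^{K−1}` (stars and bars, `multichoose_le_succ_pow` of the cell). [folklore] -/
theorem liveBreaks_card_succ_le_succ_pow (d : Fin K → ℕ) (S : Fin K → Matrix (Fin m) (Fin m) ℝ) (hK : 0 < K) :
    (liveBreaks d S).card + 1 ≤ (m + 1) ^ (K - 1) := by
  have h1 := liveBreaks_card_le_multichoose d S
  have h2 := Summit.ValiantsHypothesis.ValiantsHypothesis.Theorems.LacunarySymmetroidMatrixDescartes.TropicalCensus.multichoose_le_succ_pow K m
  have h3 : 1 ≤ Nat.multichoose K m := by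
    obtain ⟨K', rfl⟩ : ∃ K', K = K' + 1 := ⟨K - 1, by omega⟩
    rw [Nat.multichoose_eq]
    exact Nat.choose_pos (by omega)
  omega

/-- … and `#liveBreaks + 1 ≤ 2^{K+m−1}` (`multichoose(K,m) = C(K+m−1, m) ≤ 2^{K+m−1}`). [folklore] -/
theorem liveBreaks_card_succ_le_two_pow (d : Fin K → ℕ) (S : Fin K → Matrix (Fin m) (Fin m) ℝ) (hK : 0 < K) :
    (liveBreaks d S).card + 1 ≤ 2 ^ (K + m - 1) := by
  have h1 := liveBreaks_card_le_multichoose d S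
  have h2 : Nat.multichoose K m ≤ 2 ^ (K + m - 1) := by
    rw [Nat.multichoose_eq]; exact Nat.choose_le_two_pow _ _
  have h3 : 1 ≤ Nat.multichoose K m := by
    obtain ⟨K', rfl⟩ : ∃ K', K = K' + 1 := ⟨K - 1, by omega⟩
    rw [Nat.multichoose_eq]
    exact Nat.choose_pos (by omega)
  omega

/-! ### The trivial regime of the SLACK form (fat cone and thin strip): nothing about masking is needed there -/

/-- **fat cone** `m ≤ B·K`: `#liveBreaks + 1 ≤ 2^{(B+1)·K}` — so `#liveBreaks ≤ 2^{C(K+⌊log₂m⌋²)}·(n+1)` for every `C ≥ B+1` and every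
`n`, whatever the tropical row. [folklore] -/
theorem liveBreaks_card_le_slack_of_cone (B : ℕ) (d : Fin K → ℕ) (S : Fin K → Matrix (Fin m) (Fin m) ℝ) (hK : 0 < K)
    (hm : m ≤ B * K) : (liveBreaks d S).card + 1 ≤ 2 ^ ((B + 1) * K) := by
  refine (liveBreaks_card_succ_le_two_pow d S hK).trans (Nat.pow_le_pow_right (by norm_num) ?_)
  have : K + m - 1 ≤ K + m := Nat.sub_le _ _
  nlinarith

/-- **thin strip** `K ≤ K₀` (few classes): `#liveBreaks + 1 ≤ (m+1)^{K₀−1} ≤ 2^{(K₀−1)(⌊log₂ m⌋+1)}`. [folklore] -/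
theorem liveBreaks_card_le_slack_of_thin (K₀ : ℕ) (d : Fin K → ℕ) (S : Fin K → Matrix (Fin m) (Fin m) ℝ) (hK : 0 < K)
    (hKK : K ≤ K₀) : (liveBreaks d S).card + 1 ≤ 2 ^ ((K₀ - 1) * (Nat.log 2 m + 1)) := by
  refine (liveBreaks_card_succ_le_succ_pow d S hK).trans ?_
  have hm : m + 1 ≤ 2 ^ (Nat.log 2 m + 1) := Nat.lt_pow_succ_log_self one_lt_two m
  calc (m + 1) ^ (K - 1) ≤ (2 ^ (Nat.log 2 m + 1)) ^ (K - 1) := Nat.pow_le_pow_left hm _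
    _ = 2 ^ ((K - 1) * (Nat.log 2 m + 1)) := by rw [← pow_mul, mul_comm]
    _ ≤ 2 ^ ((K₀ - 1) * (Nat.log 2 m + 1)) := Nat.pow_le_pow_right (by norm_num) (Nat.mul_le_mul_right _ (by omega))

/-- **octaves in the fat cone** (PROVED, dead classes allowed): under `LiveDepthLE Δ` and `m ≤ B·K`,
`octaveCount ≤ (2(M+Δ)+2)·(2^{(B+1)K} − 1)`, `M = m(⌊log₂(mK)⌋+1)` — the slack dead-class lifting in that regime, by counting alone.
[folklore] -/
theorem octaveCount_le_slack_of_cone (B Δ : ℕ) (d : Fin K → ℕ) (S : Fin K → Matrix (Fin m) (Fin m) ℝ) (hK : 0 < K)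
    (hm : m ≤ B * K) (hΔ : LiveDepthLE d S Δ) :
    octaveCount (pencilDet d S) ≤ (2 * (m * (Nat.log 2 (m * K) + 1) + Δ) + 2) * (2 ^ ((B + 1) * K) - 1) := by
  refine (octaveCount_le_liveBreaks Δ d S hΔ).trans (Nat.mul_le_mul_left _ ?_)
  have := liveBreaks_card_le_slack_of_cone B d S hK hm
  omega

/-- **octaves in the thin strip** (PROVED, dead classes allowed): under `LiveDepthLE Δ` and `K ≤ K₀`,
`octaveCount ≤ (2(M+Δ)+2)·(2^{(K₀−1)(⌊log₂m⌋+1)} − 1)`. [folklore] -/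
theorem octaveCount_le_slack_of_thin (K₀ Δ : ℕ) (d : Fin K → ℕ) (S : Fin K → Matrix (Fin m) (Fin m) ℝ) (hK : 0 < K)
    (hKK : K ≤ K₀) (hΔ : LiveDepthLE d S Δ) :
    octaveCount (pencilDet d S) ≤ (2 * (m * (Nat.log 2 (m * K) + 1) + Δ) + 2) * (2 ^ ((K₀ - 1) * (Nat.log 2 m + 1)) - 1) := by
  refine (octaveCount_le_liveBreaks Δ d S hΔ).trans (Nat.mul_le_mul_left _ ?_)
  have := liveBreaks_card_le_slack_of_thin K₀ d S hK hKK
  omega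

end LiveCount

end Summit.ValiantsHypothesis.ValiantsHypothesis.Theorems.KPlusLogSqLaw.Octave
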